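import Summits.KontsevichZagierPeriods.KontsevichZagierPeriods.Theorems.FiveTermTransfer.Negative.Algebraicity

/-!
# `ZagierDilogarithmConjecture` (stmt-KontsevichZagierPeriods-10550) — negative knowledge I: mirror symmetry and the cheap load-bearing facts

Support file (refuter, cdisprove seat; work file `Cruxes/ZagierDilogarithmConjecture/Disproof.lean`)
for the open-conjecture item `HyperbolicBloch.ZagierDilogarithmConjecture` (Zagier's conjecture on
`ℚ`-linear relations among Bloch–Wigner values at algebraic arguments, volume / `ℤ`-form; Neumann
1998 §2.1). Nothing here asserts the conjecture. Contents: `crux_iff` (route decl ↔ Literature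
`ZagierDilogarithmRelationsConjecture`); `idealTetrahedron_eq_empty_of_im_nonpos` (`T(z) = ∅` for
`Im z ≤ 0`); `idealTetrahedronVolume_one_sub_conj` (mirror symmetry `vol T(1 − z̄) = vol T(z)`:
the reflection `x ↦ 1 − x` of upper half space preserves Lebesgue measure); the coefficient
functional and `zagier_false_without_algebraic` (algebraicity of the points is load-bearing;
witness the mirror pair at the tree's transcendental point `xL = L + i`, `L` Liouville's
constant); `not_volume_injective` (`vol T(i) = vol T(1+i)`) and `zagier_false_without_fiveTerm`
(the five-term family of relators is load-bearing). Parts II–IV: `DehnInvariant`, `DehnWitness`,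
`LoadBearing`. Sorry-free, axioms ⊆ {propext, Classical.choice, Quot.sound}.
-/

noncomputable section

open Complex MeasureTheory Set
open scoped ComplexConjugate

namespace Summit.KontsevichZagierPeriods.HyperbolicBloch.ZagierDilogarithmConjectureNegative

open Literature.NumberTheory.Transcendental
open Summit.KontsevichZagierPeriods.KontsevichZagierPeriods.Theses.HyperbolicBloch
  (ZagierDilogarithmConjecture)
open Summit.KontsevichZagierPeriods.HyperbolicBloch.FiveTermTransferNegative
  (L not_isAlgebraic_L xL xL_re xL_im not_isAlgebraic_xL isAlgebraic_of_eq_rat)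

/-! ## §0 The crux is the Literature conjecture `ZagierDilogarithmRelationsConjecture` -/

/-- **Unfolding.** The route decl (binder `∀ T, (∀ z, T z = {…}) → …`) is equivalent to the named
Literature conjecture stated with `idealTetrahedron`, `idealTetrahedronVolume`, `dilogRelators`.
[cite: Neumann1998, §2.1 end (pp. 393–394): Zagier's conjecture] -/
theorem crux_iff : ZagierDilogarithmConjecture ↔ ZagierDilogarithmRelationsConjecture := by
  constructor
  · intro h
    exact ZagierDilogarithmRelationsConjecture.of_inline idealTetrahedron (fun _ => rfl)
      (h idealTetrahedron (fun _ => rfl))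
  · intro h T hT
    exact h.inline T hT

/-! ## §1 Degenerate parameters: `T(z) = ∅` off the upper half plane -/

/-- For `Im z ≤ 0` the region `T(z)` is EMPTY (the two edge inequalities through `z` force
`p 1 < Im z`): the lower half plane and the real line carry no solid, so their "volume" is the
honest `0`, not Bochner junk. This is why the crux quantifies `0 < Im zᵢ` and why the
sign convention `B(w̄) = −B(w)` of `FiveTermTransfer` is needed. [folklore] -/
theorem idealTetrahedron_eq_empty_of_im_nonpos {z : ℂ} (hz : z.im ≤ 0) :
    idealTetrahedron z = ∅ := by
  ext p
  simp only [mem_idealTetrahedron_iff, mem_empty_iff_false, iff_false]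
  rintro ⟨h1, h2, h3, -, -⟩
  nlinarith

/-- Hence the volume functional vanishes identically off the upper half plane. [folklore] -/
theorem idealTetrahedronVolume_eq_zero_of_im_nonpos {z : ℂ} (hz : z.im ≤ 0) :
    idealTetrahedronVolume z = 0 := by
  simp [idealTetrahedronVolume, idealTetrahedron_eq_empty_of_im_nonpos hz]

/-! ## §2 The mirror symmetry `vol T(1 − z̄) = vol T(z)` (reflection `x ↦ 1 − x` of `ℍ³`) -/

/-- The reflection `(x, y, t) ↦ (1 − x, y, t)` of `ℝ³` as a measurable equivalence. [folklore] -/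
def mirrorEquiv : (Fin 3 → ℝ) ≃ᵐ (Fin 3 → ℝ) :=
  MeasurableEquiv.piCongrRight fun i : Fin 3 =>
    if i = 0 then MeasurableEquiv.subLeft (1 : ℝ) else MeasurableEquiv.refl ℝ

/-- Auxiliary: `mirrorEquiv_apply`. [folklore] -/
theorem mirrorEquiv_apply (p : Fin 3 → ℝ) (i : Fin 3) :
    mirrorEquiv p i = if i = 0 then 1 - p i else p i := by
  unfold mirrorEquiv
  by_cases h : i = 0
  · subst h; simp [MeasurableEquiv.piCongrRight, MeasurableEquiv.subLeft]
  · simp [MeasurableEquiv.piCongrRight, h]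

/-- Auxiliary: `mirrorEquiv_apply_zero`. [folklore] -/
@[simp] theorem mirrorEquiv_apply_zero (p : Fin 3 → ℝ) : mirrorEquiv p 0 = 1 - p 0 := by
  rw [mirrorEquiv_apply]; rfl

/-- Auxiliary: `mirrorEquiv_apply_one`. [folklore] -/
@[simp] theorem mirrorEquiv_apply_one (p : Fin 3 → ℝ) : mirrorEquiv p 1 = p 1 := by
  rw [mirrorEquiv_apply]; exact if_neg (by decide)

/-- Auxiliary: `mirrorEquiv_apply_two`. [folklore] -/
@[simp] theorem mirrorEquiv_apply_two (p : Fin 3 → ℝ) : mirrorEquiv p 2 = p 2 := by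
  rw [mirrorEquiv_apply]; exact if_neg (by decide)

/-- The coordinate maps of the reflection: `x ↦ 1 − x` in coordinate `0`, identity elsewhere. -/
def mirrorCoord (i : Fin 3) (x : ℝ) : ℝ := if i = 0 then 1 - x else x

/-- Each coordinate map preserves Lebesgue measure on `ℝ`. [folklore] -/
theorem measurePreserving_mirrorCoord (i : Fin 3) :
    MeasurePreserving (mirrorCoord i) (volume : Measure ℝ) volume := by
  by_cases h : i = 0
  · have e : mirrorCoord i = fun x : ℝ => (1 : ℝ) - x := funext fun x => if_pos h
    rw [e]
    exact Measure.measurePreserving_sub_left volume (1 : ℝ)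
  · have e : mirrorCoord i = id := funext fun x => if_neg h
    rw [e]
    exact MeasurePreserving.id volume

/-- The reflection preserves Lebesgue measure on `ℝ³` (product of `x ↦ 1 − x` and identities).
[folklore] -/
theorem measurePreserving_mirrorEquiv : MeasurePreserving mirrorEquiv volume volume := by
  have e : (⇑mirrorEquiv) = fun (a : Fin 3 → ℝ) (i : Fin 3) => mirrorCoord i (a i) := by
    funext a i
    rw [mirrorEquiv_apply]
    rfl
  rw [e, MeasureTheory.volume_pi]
  exact measurePreserving_pi (fun _ : Fin 3 => (volume : Measure ℝ))
    (fun _ : Fin 3 => (volume : Measure ℝ)) measurePreserving_mirrorCoord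

/-- `T(1 − z̄)` is the mirror image of `T(z)` under `x ↦ 1 − x`. [folklore] -/
theorem preimage_mirrorEquiv_idealTetrahedron (z : ℂ) :
    mirrorEquiv ⁻¹' (idealTetrahedron z) = idealTetrahedron (1 - conj z) := by
  ext p
  have hN : Complex.normSq z = z.re * z.re + z.im * z.im := Complex.normSq_apply z
  have hre : (1 - conj z).re = 1 - z.re := by simp
  have him : (1 - conj z).im = z.im := by simp
  have hN' : Complex.normSq (1 - conj z) = (1 - z.re) * (1 - z.re) + z.im * z.im := by
    rw [Complex.normSq_apply, hre, him]
  simp only [mem_preimage, mem_idealTetrahedron_iff, mirrorEquiv_apply_zero, mirrorEquiv_apply_one,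
    mirrorEquiv_apply_two, hre, him, hN', hN]
  have key : z.im * ((1 - p 0) ^ 2 + p 1 ^ 2 + p 2 ^ 2 - (1 - p 0)) +
      (z.re - (z.re * z.re + z.im * z.im)) * p 1 =
      z.im * (p 0 ^ 2 + p 1 ^ 2 + p 2 ^ 2 - p 0) +
        (1 - z.re - ((1 - z.re) * (1 - z.re) + z.im * z.im)) * p 1 := by ring
  constructor
  · rintro ⟨h1, h2, h3, h4, h5⟩
    refine ⟨h1, by linarith, by linarith, h4, by linarith⟩
  · rintro ⟨h1, h2, h3, h4, h5⟩
    refine ⟨h1, by linarith, by linarith, h4, by linarith⟩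

/-- **Mirror symmetry of the volume**: `vol T(1 − z̄) = vol T(z)` for every `z` (no algebraicity,
no sign condition; both sides are junk-free set integrals related by a measure-preserving
reflection). Geometrically: `T(z)` and `T(1 − z̄)` are mirror-image ideal tetrahedra
(`D(1 − z̄) = D(z)`). [folklore] -/
theorem idealTetrahedronVolume_one_sub_conj (z : ℂ) :
    idealTetrahedronVolume (1 - conj z) = idealTetrahedronVolume z := by
  unfold idealTetrahedronVolume
  rw [← preimage_mirrorEquiv_idealTetrahedron]
  have h := measurePreserving_mirrorEquiv.setIntegral_preimage_emb mirrorEquiv.measurableEmbedding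
    (fun p : Fin 3 → ℝ => 1 / p 2 ^ 3) (idealTetrahedron z)
  simpa using h

/-! ## §3 Load-bearing hypothesis: algebraicity of the points -/

/-! The transcendental point `xL = L + i` (`L = Σ 2^{-k!}` Liouville's constant) and its
non-algebraicity are the tree's (`FiveTermTransferNegative.xL`, `not_isAlgebraic_xL`). -/

/-- The mirror point `1 − x̄L = (1 − L) + i` differs from `xL` (`L ≠ 1/2`, `L` being
transcendental). [folklore] -/
theorem one_sub_conj_xL_ne : 1 - conj xL ≠ xL := by
  intro e
  have h := congrArg Complex.re e
  simp only [sub_re, one_re, conj_re, xL_re] at h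
  have hL : L = (2 : ℝ)⁻¹ := by linarith
  have h2 : IsAlgebraic ℚ ((2 : ℝ)⁻¹) := by
    simpa using (isAlgebraic_nat (R := ℚ) (A := ℝ) 2).inv
  apply not_isAlgebraic_L
  rw [hL]
  exact h2

/-! ### The coefficient functional and the relators -/

/-- Coefficient extraction at `w`: the additive map `ℤ[ℂ] → ℤ`, `[w] ↦ 1`, `[w'] ↦ 0`. [folklore] -/
def coeffAt (w : ℂ) : FreeAbelianGroup ℂ →+ ℤ :=
  FreeAbelianGroup.lift fun w' => if w' = w then 1 else 0

/-- Auxiliary: `coeffAt_of`. [folklore] -/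
@[simp] theorem coeffAt_of (w w' : ℂ) :
    coeffAt w (FreeAbelianGroup.of w') = if w' = w then 1 else 0 := by
  simp [coeffAt]

/-- Auxiliary: `coeffAt_of_ne`. [folklore] -/
theorem coeffAt_of_ne {w w' : ℂ} (h : w' ≠ w) : coeffAt w (FreeAbelianGroup.of w') = 0 := by
  simp [h]

/-- Auxiliary: `coeffAt_of_self`. [folklore] -/
theorem coeffAt_of_self (w : ℂ) : coeffAt w (FreeAbelianGroup.of w) = 1 := by
  simp

/-- The five arguments of a five-term relator with algebraic `x, y` are algebraic. [folklore] -/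
theorem isAlgebraic_fiveTerm_args {x y : ℂ} (hx : IsAlgebraic ℚ x) (hy : IsAlgebraic ℚ y) :
    IsAlgebraic ℚ (y / x) ∧ IsAlgebraic ℚ ((1 - x⁻¹) / (1 - y⁻¹)) ∧
      IsAlgebraic ℚ ((1 - x) / (1 - y)) := by
  have h1 : IsAlgebraic ℚ (1 : ℂ) := by simpa using isAlgebraic_nat (R := ℚ) (A := ℂ) 1
  refine ⟨?_, ?_, ?_⟩
  · rw [div_eq_mul_inv]; exact hy.mul hx.inv
  · rw [div_eq_mul_inv]; exact (h1.sub hx.inv).mul (h1.sub hy.inv).inv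
  · rw [div_eq_mul_inv]; exact (h1.sub hx).mul (h1.sub hy).inv

/-- A transcendental, non-real point has coefficient `0` in every dilogarithm relator (all relator
entries are algebraic or real). [folklore] -/
theorem coeffAt_eq_zero_of_mem_dilogRelators {w : ℂ} (hw : ¬ IsAlgebraic ℚ w) (hwim : w.im ≠ 0)
    {c : FreeAbelianGroup ℂ} (hc : c ∈ dilogRelators) : coeffAt w c = 0 := by
  have ne : ∀ v : ℂ, IsAlgebraic ℚ v → v ≠ w := fun v hv e => hw (e ▸ hv)
  rcases hc with (⟨x, y, hx, hy, -, -, -, -, -, rfl⟩ | ⟨u, hu, rfl⟩) | ⟨u, hu, rfl⟩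
  · obtain ⟨h1, h2, h3⟩ := isAlgebraic_fiveTerm_args hx hy
    simp only [map_add, map_sub, coeffAt_of_ne (ne _ hx), coeffAt_of_ne (ne _ hy),
      coeffAt_of_ne (ne _ h1), coeffAt_of_ne (ne _ h2), coeffAt_of_ne (ne _ h3)]
    norm_num
  · have hu' : IsAlgebraic ℚ (conj u) := hu.algHom (starRingEnd ℂ).toRatAlgHom
    simp only [map_add, coeffAt_of_ne (ne _ hu), coeffAt_of_ne (ne _ hu'), add_zero]
  · have ne1 : u ≠ w := fun e => hwim (e ▸ hu)
    exact coeffAt_of_ne ne1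

/-- Hence it has coefficient `0` in the whole relator subgroup. [folklore] -/
theorem coeffAt_eq_zero_of_mem_closure {w : ℂ} (hw : ¬ IsAlgebraic ℚ w) (hwim : w.im ≠ 0)
    {c : FreeAbelianGroup ℂ} (hc : c ∈ AddSubgroup.closure dilogRelators) : coeffAt w c = 0 := by
  have hle : AddSubgroup.closure dilogRelators ≤ (coeffAt w).ker :=
    (AddSubgroup.closure_le _).mpr fun c hc => coeffAt_eq_zero_of_mem_dilogRelators hw hwim hc
  exact hle hc

/-- **The crux with the hypothesis `∀ i, IsAlgebraic ℚ (z i)` dropped** (relators unchanged;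
Literature names, cf. `crux_iff`). -/
def ZagierWithoutAlgebraic : Prop :=
  ∀ (k : ℕ) (z : Fin k → ℂ) (n : Fin k → ℤ), (∀ i, 0 < (z i).im) →
    ∑ i, (n i : ℝ) * idealTetrahedronVolume (z i) = 0 →
      (∑ i, n i • FreeAbelianGroup.of (z i)) ∈ AddSubgroup.closure dilogRelators

/-- **Any proof must use the algebraicity of the points.** Witness: the mirror pair
`[L + i] − [(1 − L) + i]` (`L` Liouville's constant) has volume sum `0` (`§2`) but coefficient `1`
at the transcendental point `L + i`, where every relator has coefficient `0`.
(Over `ℂ` the true relation group is the full `𝒫(ℂ)⁺ +` five-term span with COMPLEX entries;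
the crux's relators only have algebraic entries.) [folklore] -/
theorem zagier_false_without_algebraic : ¬ ZagierWithoutAlgebraic := by
  intro h
  have him : ∀ i : Fin 2, 0 < ((![xL, 1 - conj xL] : Fin 2 → ℂ) i).im := by
    intro i
    fin_cases i <;> simp
  have hvol : ∑ i : Fin 2, ((![1, -1] : Fin 2 → ℤ) i : ℝ) *
      idealTetrahedronVolume ((![xL, 1 - conj xL] : Fin 2 → ℂ) i) = 0 := by
    simp [Fin.sum_univ_two, idealTetrahedronVolume_one_sub_conj]
  have hmem := h 2 ![xL, 1 - conj xL] ![1, -1] him hvol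
  have h0 := coeffAt_eq_zero_of_mem_closure not_isAlgebraic_xL (by simp) hmem
  simp [Fin.sum_univ_two, coeffAt_of_ne one_sub_conj_xL_ne] at h0

/-! ## §4 Two refuted naive strengthenings (cheap, by the mirror symmetry) -/

/-- Auxiliary: `isAlgebraic_one_add_I`. [folklore] -/
theorem isAlgebraic_one_add_I : IsAlgebraic ℚ (1 + I) :=
  isAlgebraic_of_eq_rat 1 1 (by simp)

/-- REFUTED STRENGTHENING 1: **the volume is not injective on the algebraic upper half plane**
(so "no non-trivial `ℤ`-relation at all among the `vol T(zᵢ)`" is false): `vol T(i) = vol T(1+i)`,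
the two tetrahedra being mirror images. The genuine statement must quotient by relators.
[folklore] -/
theorem not_volume_injective :
    ¬ ∀ z w : ℂ, IsAlgebraic ℚ z → IsAlgebraic ℚ w → 0 < z.im → 0 < w.im →
      idealTetrahedronVolume z = idealTetrahedronVolume w → z = w := by
  intro h
  have e : idealTetrahedronVolume (1 + I) = idealTetrahedronVolume I := by
    simpa using idealTetrahedronVolume_one_sub_conj I
  have := h (1 + I) I isAlgebraic_one_add_I (isAlgebraic_of_eq_rat 0 1 (by push_cast; ring)) (by simp) (by simp) e
  simpa using congrArg Complex.re this

/-- The crux with the FIVE-TERM family deleted from the relators (keeping `[w] + [w̄]` and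
`[w]`, `w` real). -/
def ZagierWithoutFiveTerm : Prop :=
  ∀ (k : ℕ) (z : Fin k → ℂ) (n : Fin k → ℤ), (∀ i, IsAlgebraic ℚ (z i)) → (∀ i, 0 < (z i).im) →
    ∑ i, (n i : ℝ) * idealTetrahedronVolume (z i) = 0 →
      (∑ i, n i • FreeAbelianGroup.of (z i)) ∈ AddSubgroup.closure
        ({c | ∃ w : ℂ, IsAlgebraic ℚ w ∧
            c = FreeAbelianGroup.of w + FreeAbelianGroup.of ((starRingEnd ℂ) w)} ∪
          {c | ∃ w : ℂ, w.im = 0 ∧ c = FreeAbelianGroup.of w})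

/-- The signed coefficient functional `[i] ↦ 1`, `[−i] ↦ −1`, else `0`: it kills `[w] + [w̄]`
and `[w]` (`w` real). [folklore] -/
def signedCoeffI : FreeAbelianGroup ℂ →+ ℤ :=
  FreeAbelianGroup.lift fun w => if w = I then 1 else if w = -I then -1 else 0

/-- Auxiliary: `signedCoeffI_of`. [folklore] -/
@[simp] theorem signedCoeffI_of (w : ℂ) :
    signedCoeffI (FreeAbelianGroup.of w) = if w = I then 1 else if w = -I then -1 else 0 := by
  simp [signedCoeffI]

/-- Auxiliary: `I_ne_neg_I'`. [folklore] -/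
theorem neg_I_ne_I : (-I : ℂ) ≠ I := by
  intro e; have := congrArg Complex.im e; norm_num at this

/-- Auxiliary: `signedCoeffI_conj_pair`. [folklore] -/
theorem signedCoeffI_conj_pair (w : ℂ) :
    signedCoeffI (FreeAbelianGroup.of w + FreeAbelianGroup.of (conj w)) = 0 := by
  rw [map_add, signedCoeffI_of, signedCoeffI_of]
  by_cases h1 : w = I
  · subst h1; simp [neg_I_ne_I]
  · by_cases h2 : w = -I
    · subst h2; simp [neg_I_ne_I]
    · have h3 : conj w ≠ I := fun e => h2 (by rw [← conj_conj w, e]; simp)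
      have h4 : conj w ≠ -I := fun e => h1 (by rw [← conj_conj w, e]; simp)
      simp [h1, h2, h3, h4]

/-- Auxiliary: `signedCoeffI_real`. [folklore] -/
theorem signedCoeffI_real {w : ℂ} (hw : w.im = 0) : signedCoeffI (FreeAbelianGroup.of w) = 0 := by
  have h1 : w ≠ I := fun e => by simp [e] at hw
  have h2 : w ≠ -I := fun e => by simp [e] at hw
  simp [h1, h2]

/-- **Any proof must use the five-term relators**: with only the conjugation and real families,
the mirror relation `vol T(i) = vol T(1 + i)` is not explained — `[i] − [1 + i]` has signed
coefficient `1`. [folklore] -/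
theorem zagier_false_without_fiveTerm : ¬ ZagierWithoutFiveTerm := by
  intro h
  have halg : ∀ j : Fin 2, IsAlgebraic ℚ ((![I, 1 + I] : Fin 2 → ℂ) j) := by
    intro j; fin_cases j
    · exact (isAlgebraic_of_eq_rat 0 1 (by push_cast; ring))
    · exact isAlgebraic_one_add_I
  have him : ∀ j : Fin 2, 0 < ((![I, 1 + I] : Fin 2 → ℂ) j).im := by
    intro j; fin_cases j <;> simp
  have hvol : ∑ j : Fin 2, ((![1, -1] : Fin 2 → ℤ) j : ℝ) *
      idealTetrahedronVolume ((![I, 1 + I] : Fin 2 → ℂ) j) = 0 := by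
    have e : idealTetrahedronVolume (1 + I) = idealTetrahedronVolume I := by
      simpa using idealTetrahedronVolume_one_sub_conj I
    simp [Fin.sum_univ_two, e]
  have hmem := h 2 ![I, 1 + I] ![1, -1] halg him hvol
  have hle : AddSubgroup.closure
      ({c | ∃ w : ℂ, IsAlgebraic ℚ w ∧
          c = FreeAbelianGroup.of w + FreeAbelianGroup.of ((starRingEnd ℂ) w)} ∪
        {c | ∃ w : ℂ, w.im = 0 ∧ c = FreeAbelianGroup.of w}) ≤ signedCoeffI.ker := by
    refine (AddSubgroup.closure_le _).mpr ?_
    rintro c (⟨w, -, rfl⟩ | ⟨w, hw, rfl⟩)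
    · exact signedCoeffI_conj_pair w
    · exact signedCoeffI_real hw
  have h0 : signedCoeffI (∑ j : Fin 2, (![1, -1] : Fin 2 → ℤ) j •
      FreeAbelianGroup.of ((![I, 1 + I] : Fin 2 → ℂ) j)) = 0 := hle hmem
  have h1 : (1 + I : ℂ) ≠ I := fun e => by simpa using congrArg Complex.re e
  have h2 : (1 + I : ℂ) ≠ -I := fun e => by simpa using congrArg Complex.re e
  simp [Fin.sum_univ_two, h1, h2] at h0

end Summit.KontsevichZagierPeriods.HyperbolicBloch.ZagierDilogarithmConjectureNegative

end
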